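import Summits.ResolutionOfSingularities.ResolutionOfSingularities.Theorems.ValuativeLuAlphaPTorsorAbhyankarDefectless
import HarnessLib

/-!
# An Abhyankar subfunction field is a defectless valued field

Crux `Valuative.LuAlphaPTorsor` (item `stmt-ResolutionOfSingularities-0641`), line
`pfaff-line-log-final-forms`, stub S1a `stub_abhyankarSubfieldDefectless` of the skeleton
reshape v6.7 — the stability input of the removal of the hypothesis "`K/F₀` separably generated"
from the dense-Abhyankar range (H. Knaf, F.-V. Kuhlmann, *Every place admits local
uniformization in a finite extension of the function field*, Adv. Math. 221 (2009) 428–453,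
Thm. 1.5 with Lemma 3.12: "every immediate extension of a defectless field is separable").

Setting: `k ⊆ K` fields, `O ⊇ k` a valuation ring of `K`, `F₀` a subfield of `K` with
`im k ≤ F₀`, finitely generated over `im k` (`FGOver`), such that `O ∩ F₀` is an Abhyankar place
of `F₀ / k` (`IsAbhyankarPlace O (im k) F₀`: non-zero `x₁, …, x_ρ ∈ F₀` with `ℤ`-independent
values, `y₁, …, y_τ ∈ O ∩ F₀` with residues algebraically independent over the residue field of
`im k`, and `F₀` algebraic over `k(x, y)`).

**Claim** (`stub_abhyankarSubfieldDefectless`). The valued field `(F₀, O ∩ F₀)` is a defectless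
(= stable) field (`IsDefectlessField`).

Proof. View `F₀` as an intermediate field `M` of `K` over the subfield `im k` (same elements).
By Knaf–Kuhlmann 2005, Thm. 2.1 with Abhyankar's inequality, an Abhyankar place of a finitely
generated extension has transcendence defect `0` — in the tree:
`transcendenceDefect_comap_eq_zero_of_isAbhyankarPlace` (type rendering of the ambient predicate).
Kuhlmann's generalized stability theorem over the trivially valued ground field `im k`
(F.-V. Kuhlmann, *Elimination of ramification I: the generalized stability theorem*, Trans. Amer.
Math. Soc. 362 (2010) 5697–5727, Thm. 1.1; PROVED in the tree as `Kuhlmann2010Stability_holds`)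
then says that `(M, O ∩ M) = (F₀, O ∩ F₀)` is a defectless field.
-/

-- single-problem summit: the doubled namespace component `ResolutionOfSingularities` is forced
set_option linter.dupNamespace false

namespace Summit.ResolutionOfSingularities.ResolutionOfSingularities.Theorems.PfaffLine

open IsLocalRing Literature.AlgebraicGeometry.Resolution

/-- **A subfield finitely generated over a subfield `K₁ ⊆ Ω` is finitely generated as an
intermediate field**: if `F = K₁(s)` for a finite `s ⊆ Ω` (`FGOver K₁ F`) and `M` is an
intermediate field of `Ω / K₁` with the same elements as `F`, then `M / K₁` is finitely generated
(`(⊤ : IntermediateField K₁ M).FG`, by the elements of `s`, which lie in `M`). [folklore] -/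
theorem fg_top_of_fgOver {Ω : Type*} [Field Ω] {K₁ F : Subfield Ω} (M : IntermediateField K₁ Ω)
    (hMF : ∀ z, z ∈ M ↔ z ∈ F) (hfg : FGOver K₁ F) : (⊤ : IntermediateField K₁ M).FG := by
  classical
  obtain ⟨s, hs⟩ := hfg
  have hsM : ∀ z ∈ s, z ∈ M := fun z hz => by
    rw [hMF, ← hs]
    exact Subfield.subset_closure (Or.inr hz)
  let s₀ : Set M := Subtype.val ⁻¹' (s : Set Ω)
  have hs₀ : s₀.Finite := s.finite_toSet.preimage Subtype.val_injective.injOn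
  refine IntermediateField.fg_def.mpr ⟨s₀, hs₀, ?_⟩
  apply IntermediateField.lift_injective M
  rw [IntermediateField.lift_adjoin, IntermediateField.lift_top]
  have himage : Subtype.val '' s₀ = (s : Set Ω) := by
    rw [Set.image_preimage_eq_iff]
    intro z hz
    exact ⟨⟨z, hsM z hz⟩, rfl⟩
  rw [himage]
  apply IntermediateField.toSubfield_injective
  rw [IntermediateField.adjoin_toSubfield]
  have hrange : Set.range (algebraMap K₁ Ω) = (K₁ : Set Ω) := Subtype.range_coe
  rw [hrange, hs]
  ext z
  exact (hMF z).symm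

/-- **An Abhyankar subfunction field is a defectless valued field** (stub S1a of the line
`pfaff-line-log-final-forms`, reshape v6.7). For fields `k ⊆ K`, a valuation ring `O ⊇ k` of
`K` and a subfield `F₀ ⊇ im k` of `K`, finitely generated over `im k`, on which `O` induces an
Abhyankar place of `F₀ / k` (`IsAbhyankarPlace O (im k) F₀`), the valued field `(F₀, O ∩ F₀)` is
defectless (`IsDefectlessField`): its transcendence defect over the trivially valued `im k`
vanishes (`transcendenceDefect_comap_eq_zero_of_isAbhyankarPlace`, Knaf–Kuhlmann 2005 Thm. 2.1
with Abhyankar's inequality), so Kuhlmann's generalized stability theorem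
(`Kuhlmann2010Stability_holds`) applies. [cite: Kuhlmann2010, Thm. 1.1] -/
theorem stub_abhyankarSubfieldDefectless :
    ∀ (k K : Type) [Field k] [Field K] [Algebra k K] (O : ValuationSubring K), (∀ c : k, algebraMap k K c ∈ O) → ∀ F₀ : Subfield K, (algebraMap k K).fieldRange ≤ F₀ → Literature.AlgebraicGeometry.Resolution.FGOver (algebraMap k K).fieldRange F₀ → Literature.AlgebraicGeometry.Resolution.IsAbhyankarPlace O (algebraMap k K).fieldRange F₀ → Literature.AlgebraicGeometry.Resolution.IsDefectlessField ↥F₀ (O.comap (algebraMap ↥F₀ K)) := by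
  intro k K _ _ _ O hk F₀ hkF₀ hfg hA
  set kK : Subfield K := (algebraMap k K).fieldRange
  -- `F₀` as an intermediate field of `K / im k`, with the same elements
  set M : IntermediateField kK K := F₀.toIntermediateField fun x => hkF₀ x.2
  have hMF : ∀ z, z ∈ M ↔ z ∈ F₀ := fun z => Iff.rfl
  -- `im k ⊆ O`
  have hKV : (kK : Set K) ⊆ O := by
    intro z hz
    obtain ⟨c, rfl⟩ := RingHom.mem_fieldRange.mp (SetLike.mem_coe.mp hz)
    exact hk c
  -- `F₀ / im k` is finitely generated
  have hfgM : (⊤ : IntermediateField kK M).FG := fg_top_of_fgOver M hMF hfg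
  -- the transcendence defect of `(F₀, O ∩ F₀)` over `im k` vanishes
  have hD := transcendenceDefect_comap_eq_zero_of_isAbhyankarPlace O M hMF hKV hfgM hA
  -- the generalized stability theorem
  exact Kuhlmann2010Stability_holds kK M hfgM (O.comap (algebraMap M K))
    (algebraMap_mem_comap_intermediateField O M hKV) hD

end Summit.ResolutionOfSingularities.ResolutionOfSingularities.Theorems.PfaffLine
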